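import Summits.FinalStateConjecture.FinalStateConjecture.Theorems.ZeroEnergyKerrOrBombErgoregionBombModTLightPointAntecedent
import Literature.Geometry.Lorentzian.StationaryVacuumModuli

/-!
# `ErgoregionBombModT` — complete on-wall rays meet only hovering light points
# (crux stmt-FinalStateConjecture-17838, line `killing-light-points`, lead c2)

Route `ZeroEnergyKerrOrBomb` of the Final State Conjecture, crux `ErgoregionBombModT`.  The
companion files (p138761, p139117, p139708) show that every Killing light point of the d.o.c.
inhabits the crux's antecedent and that the crux is exactly `OffWallBomb ∧ LightPointBomb`.  The
planners asked whether restating the crux with `s = Set.univ` (COMPLETE trapped rays only) is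
advisable.  This file certifies what that restate does to the light-point half: a complete geodesic
cannot pass, with velocity parallel to `T`, through an INCOMPLETE (`κ ≠ 0`) light point of the
d.o.c. — so under `s = univ` the on-wall branch consists of HOVERING light points only
(`LightPointBomb` shrinks to its hovering species; the off-wall half is untouched).

* `false_of_complete_geodesic_through_incompleteLightPoint` — if `ρ` is a geodesic on all of `ℝ`
  with values in `⟨⟨M_ext⟩⟩`, `ρ t₀ = p`, `ρ̇(t₀) = c₀ T_p` (`c₀ ≠ 0`) at a light point `p` with
  `∇_T T = κ T`, `κ ≠ 0`, then `False`: by uniqueness of geodesics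
  (`IsGeodesicOn.eqOn_of_velocity_eq_holds`) an affine reparametrisation of `ρ` coincides on the
  half-line `{0 < κ s}` with the logarithmic reparametrisation `γ(s) = σ(log(κ s)/κ)` of the orbit
  (p139117), and continuity of `ρ` through `s = 0` forces `T = lim (κ s) γ̇(s) = 0` at a point of
  `ρ`, i.e. of the d.o.c., where `T ≠ 0`;
* `onWall_complete_ray_isHovering` — in the crux's telescope: a maximal zero-energy null geodesic
  with domain `univ`, trapped modulo the flow and never entering `{g(T,T) > 0}`, consists of
  HOVERING light points (`∇_T T = 0` and `g(T,T) = 0` at every `γ t`).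

References: O'Neill 1983, Ch. 3, Lemma 3.22 and p. 68 (uniqueness of geodesics), Prop. 3.18;
Hawking–Ellis 1973, §9.3 p. 331; crux workfile `Cruxes/ErgoregionBombModT/Lines/killing-light-points.md`.
-/

noncomputable section

open Bundle Set Filter Function
open scoped Manifold Topology ContDiff

-- summit = problem name (D-0017)
set_option linter.dupNamespace false

namespace Summit.FinalStateConjecture.FinalStateConjecture.Theorems.ErgoregionBombModT

open Literature.Geometry.Lorentzian

variable {𝓑 : StationaryAFBlackHole.{0}} [𝓑.metric.HasLeviCivita]

/-- **No complete geodesic runs along an incomplete light line.**  Let `p ∈ ⟨⟨M_ext⟩⟩` be a light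
point with `g(T,T)(p) = 0`, `∇_T T = κ T`, `κ ≠ 0`, and let `ρ` be a geodesic on all of `ℝ` with
values in the d.o.c., `ρ t₀ = p` and `ρ̇(t₀) = c₀ T_p`, `c₀ ≠ 0`.  Then `False`: the affine
reparametrisation `s ↦ ρ(c₀⁻¹ s + t₀ - c₀⁻¹/κ)` has the same position and velocity at `s = 1/κ` as
the logarithmic reparametrisation `γ(s) = σ(log(κ s)/κ)` of the orbit through `p` (a geodesic on
`{0 < κ s}`, p139117), so the two agree there (O'Neill 1983, Ch. 3, Lemma 3.22); but `ρ` is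
continuous through `s = 0`, and along `{0 < κ s}` one has `T = (κ s) γ̇(s) → 0`, so `T` vanishes at
a point of `ρ`, contradicting `T ≠ 0` on the d.o.c. [cite: ONeill1983, Ch. 3, Lemma 3.22] -/
theorem false_of_complete_geodesic_through_incompleteLightPoint
    (hT0 : ∀ p ∈ 𝓑.doc, 𝓑.killing p ≠ 0)
    {p : 𝓑.carrier} (hp : p ∈ 𝓑.doc) (hlam : 𝓑.metric.val p (𝓑.killing p) (𝓑.killing p) = 0)
    {κ : ℝ} (hκ : κ ≠ 0)
    (hacc : 𝓑.metric.leviCivita 𝓑.killing p (𝓑.killing p) = κ • 𝓑.killing p)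
    {ρ : ℝ → 𝓑.carrier} (hρ : IsGeodesicOn 𝓑.metric.toPseudoRiemannianMetric.leviCivita ρ univ)
    (hρdoc : ∀ t, ρ t ∈ 𝓑.doc) {t₀ c₀ : ℝ} (hρ0 : ρ t₀ = p) (hc₀ : c₀ ≠ 0)
    (hρv : velocity (𝓡 4) ρ t₀ = c₀ • 𝓑.killing p) : False := by
  set cov := 𝓑.metric.toPseudoRiemannianMetric.leviCivita with hcov_def
  -- the orbit through `p` and the transported light-point data
  obtain ⟨σ, hσ, hσ0⟩ := 𝓑.isStationaryKilling.isCompleteVectorField p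
  subst hσ0
  have hdoc : ∀ τ, σ τ ∈ 𝓑.doc := fun τ ↦ StationaryAFBlackHole.mem_doc_of_isMIntegralCurve hσ hp τ
  have hnull : ∀ τ, 𝓑.metric.val (σ τ) (𝓑.killing (σ τ)) (𝓑.killing (σ τ)) = 0 := fun τ ↦ by
    rw [val_killing_self_of_isMIntegralCurve hσ τ]
    exact hlam
  have haccτ : ∀ τ, 𝓑.metric.leviCivita 𝓑.killing (σ τ) (𝓑.killing (σ τ)) = κ • 𝓑.killing (σ τ) :=
    leviCivita_killing_self_of_isMIntegralCurve hσ hacc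
  -- the reparametrisation `γ s = σ (log (κ s) / κ)` on `D = {s | 0 < κ s}`
  set c : ℝ → ℝ := fun s ↦ (κ * s)⁻¹ with hc_def
  set ϑ : ℝ → ℝ := fun s ↦ Real.log (κ * s) / κ with hϑ_def
  set γ : ℝ → 𝓑.carrier := fun s ↦ σ (ϑ s) with hγ_def
  set D : Set ℝ := {s | 0 < κ * s} with hD_def
  have hDopen : IsOpen D := isOpen_lt continuous_const (continuous_const.mul continuous_id)
  have hDord : D.OrdConnected := by
    refine ⟨fun a ha b hb x hx ↦ ?_⟩
    simp only [hD_def, mem_setOf_eq] at ha hb ⊢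
    rcases le_or_gt 0 κ with hk | hk
    · have := mul_le_mul_of_nonneg_left hx.1 hk
      linarith
    · have := mul_le_mul_of_nonpos_left hx.2 hk.le
      linarith
  have hD0 : ∀ s ∈ D, s ≠ 0 := by
    rintro s hs rfl
    simp [hD_def] at hs
  have hDκ : 1 / κ ∈ D := by
    simp only [hD_def, mem_setOf_eq, mul_one_div_cancel hκ]
    exact one_pos
  -- differentiability of the pieces at `s ≠ 0`
  have hϑ : ∀ s ≠ 0, HasDerivAt ϑ (c s) s := fun s hs ↦ hasDerivAt_log_mul_div hκ hs
  have hϑm : ∀ s ≠ 0, MDifferentiableAt 𝓘(ℝ, ℝ) 𝓘(ℝ, ℝ) ϑ s := fun s hs ↦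
    mdifferentiableAt_iff_differentiableAt.mpr (hϑ s hs).differentiableAt
  have hγm : ∀ s ≠ 0, MDifferentiableAt 𝓘(ℝ, ℝ) (𝓡 4) γ s := fun s hs ↦
    (hσ (ϑ s)).mdifferentiableAt.comp s (hϑm s hs)
  have hcd : ∀ s ≠ 0, HasDerivAt c (-κ / (κ * s) ^ 2) s := fun s hs ↦ hasDerivAt_inv_mul hκ hs
  -- the velocity of `γ`
  have hvel : ∀ s ≠ 0, velocity (𝓡 4) γ s = c s • 𝓑.killing (γ s) := by
    intro s hs
    have hϑ' : HasMFDerivAt 𝓘(ℝ, ℝ) 𝓘(ℝ, ℝ) ϑ s (ContinuousLinearMap.toSpanSingleton ℝ (c s)) :=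
      hasMFDerivAt_iff_hasFDerivAt.2 (hϑ s hs).hasFDerivAt
    have hcomp := (hσ (ϑ s)).comp s hϑ'
    show velocity (𝓡 4) (σ ∘ ϑ) s = c s • 𝓑.killing (σ (ϑ s))
    rw [velocity, hcomp.mfderiv]
    change ((1 : ℝ) • c s) • 𝓑.killing (σ (ϑ s)) = c s • 𝓑.killing (σ (ϑ s))
    rw [one_smul]
  -- the section `T ∘ γ` along `γ` has a differentiable lift
  have hW : ∀ s ≠ 0, MDifferentiableAt 𝓘(ℝ, ℝ) (𝓡 4).tangent
      (fun s ↦ (TotalSpace.mk' E4 (γ s) (𝓑.killing (γ s)) : TangentBundle (𝓡 4) 𝓑.carrier)) s :=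
    fun s hs ↦ (mdifferentiableAt_killing (γ s)).comp s (hγm s hs)
  -- the tangent lift of `γ` is differentiable at `s ≠ 0`
  have hlift : ∀ s ≠ 0, MDifferentiableAt 𝓘(ℝ, ℝ) (𝓡 4).tangent (tangentLift (𝓡 4) γ) s := by
    intro s hs
    set e := trivializationAt E4 (TangentSpace (𝓡 4) : 𝓑.carrier → Type _) (γ s) with he_def
    have hev : ∀ᶠ s' in 𝓝 s, s' ≠ 0 := isOpen_ne.mem_nhds hs
    have hbase : ∀ᶠ s' in 𝓝 s, γ s' ∈ e.baseSet :=
      (hγm s hs).continuousAt.preimage_mem_nhds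
        (e.open_baseSet.mem_nhds (FiberBundle.mem_baseSet_trivializationAt' (γ s)))
    -- the model: `s' ↦ (γ s', c s' • T (γ s'))`
    have hmodel : MDifferentiableAt 𝓘(ℝ, ℝ) (𝓡 4).tangent
        (fun s' ↦ (TotalSpace.mk' E4 (γ s') (c s' • 𝓑.killing (γ s')) :
          TangentBundle (𝓡 4) 𝓑.carrier)) s := by
      have hWs := hW s hs
      rw [mdifferentiableAt_totalSpace] at hWs ⊢
      refine ⟨hγm s hs, ?_⟩
      have h2 : MDifferentiableAt 𝓘(ℝ, ℝ) 𝓘(ℝ, E4)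
          (fun s' ↦ c s' • (e (TotalSpace.mk' E4 (γ s') (𝓑.killing (γ s')))).2) s := by
        have hc' : DifferentiableAt ℝ c s := (hcd s hs).differentiableAt
        have hw' : DifferentiableAt ℝ
            (fun s' ↦ (e (TotalSpace.mk' E4 (γ s') (𝓑.killing (γ s')))).2) s :=
          mdifferentiableAt_iff_differentiableAt.mp hWs.2
        exact mdifferentiableAt_iff_differentiableAt.mpr (hc'.smul hw')
      refine h2.congr_of_eventuallyEq ?_
      filter_upwards [hbase] with s' hs'
      exact (e.linear ℝ hs').map_smul (c s') (𝓑.killing (γ s'))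
    refine hmodel.congr_of_eventuallyEq ?_
    filter_upwards [hev] with s' hs'
    simp only [tangentLift, hvel s' hs']
  -- locality of `D/ds` in the field along `γ`
  have hcongr : ∀ {W W' : Π t : ℝ, TangentSpace (𝓡 4) (γ t)} {t₀ : ℝ},
      (∀ᶠ t in 𝓝 t₀, W' t = W t) →
        covariantDerivAlong cov γ W' t₀ = covariantDerivAlong cov γ W t₀ := by
    intro W W' t₀ h
    simp only [covariantDerivAlong, covariantDerivAlongFrame]
    have h0 : W' t₀ = W t₀ := h.self_of_nhds
    congr 1
    · refine Finset.sum_congr rfl fun i _ ↦ ?_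
      congr 1
      apply Filter.EventuallyEq.deriv_eq
      filter_upwards [h] with t ht
      rw [ht]
    · rw [h0]
  -- the geodesic equation at `s ≠ 0`
  have hgeq : ∀ s ≠ 0, covariantDerivAlong cov γ (fun t ↦ velocity (𝓡 4) γ t) s = 0 := by
    intro s hs
    have hev : ∀ᶠ s' in 𝓝 s, s' ≠ 0 := isOpen_ne.mem_nhds hs
    have h1 : covariantDerivAlong cov γ (fun t ↦ velocity (𝓡 4) γ t) s =
        covariantDerivAlong cov γ (fun t ↦ c t • 𝓑.killing (γ t)) s :=
      hcongr (by filter_upwards [hev] with t ht using hvel t ht)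
    have h2 := covariantDerivAlong_smul_holds cov (γ := γ) (W := fun t ↦ 𝓑.killing (γ t)) (f := c)
      (t₀ := s) (hcd s hs).differentiableAt (hW s hs)
    have h3 := covariantDerivAlong_comp_holds cov (γ := γ) (Y := 𝓑.killing) (t₀ := s) (hγm s hs)
      (mdifferentiableAt_killing (γ s))
    rw [h1, h2, h3, hvel s hs, map_smul, (hcd s hs).deriv]
    change (-κ / (κ * s) ^ 2) • 𝓑.killing (γ s) +
        c s • c s • 𝓑.metric.leviCivita 𝓑.killing (σ (ϑ s)) (𝓑.killing (σ (ϑ s))) = 0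
    rw [haccτ (ϑ s), smul_smul, smul_smul, ← add_smul]
    have : -κ / (κ * s) ^ 2 + c s * c s * κ = 0 := by
      simp only [hc_def]
      field_simp
      ring
    rw [this, zero_smul]
  have hgeo : IsGeodesicOn cov γ D :=
    ⟨fun s hs ↦ hlift s (hD0 s hs), fun s hs ↦ hgeq s (hD0 s hs)⟩

  -- the affine reparametrisation of `ρ` with the data of `γ` at `s = 1/κ`
  set a : ℝ := c₀⁻¹ with ha_def
  set b : ℝ := t₀ - c₀⁻¹ / κ with hb_def
  set ρa : ℝ → 𝓑.carrier := fun s ↦ ρ (a * s + b) with hγt_def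
  have hab : a * (1 / κ) + b = t₀ := by
    simp only [ha_def, hb_def]
    ring
  have hρageo : IsGeodesicOn cov ρa univ := by
    have h := IsGeodesicOn.comp_affine_holds (cov := cov) hρ a b
    rwa [Set.preimage_univ] at h
  have hϑ1 : ϑ (1 / κ) = 0 := by
    simp only [hϑ_def, mul_one_div_cancel hκ, Real.log_one, zero_div]
  have h0eq : ρa (1 / κ) = γ (1 / κ) := by
    simp only [hγt_def, hγ_def, hab, hρ0, hϑ1]
  have hveq : velocity (𝓡 4) ρa (1 / κ) = velocity (𝓡 4) γ (1 / κ) := by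
    have h1 : velocity (𝓡 4) ρa (1 / κ) = a • velocity (𝓡 4) ρ (a * (1 / κ) + b) :=
      velocity_comp_affine ρ a b (1 / κ)
    rw [h1, hab, hρv, hvel (1 / κ) (one_div_ne_zero hκ)]
    have hac : a * c₀ = 1 := by simp only [ha_def, inv_mul_cancel₀ hc₀]
    have hcκ : c (1 / κ) = 1 := by simp only [hc_def, mul_one_div_cancel hκ, inv_one]
    have hγ1 : γ (1 / κ) = σ 0 := by simp only [hγ_def, hϑ1]
    show (a • (c₀ • 𝓑.killing (σ 0)) : E4) = (c (1 / κ) • 𝓑.killing (γ (1 / κ)) : E4)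
    rw [𝓑.killing_congr hγ1, smul_smul, hac, one_smul, hcκ, one_smul]
  have hk : ((1 : ℕ∞) : ℕ∞ω) + 1 ≤ ((⊤ : ℕ∞) : ℕ∞ω) := by exact_mod_cast le_top
  haveI : CovariantDerivative.ContMDiffCovariantDerivative cov 1 :=
    ⟨PseudoRiemannianMetric.isLocallyContMDiff_leviCivita_holds
      (g := 𝓑.metric.toPseudoRiemannianMetric) 1 hk univ isOpen_univ⟩
  have huniq : EqOn ρa γ D :=
    IsGeodesicOn.eqOn_of_velocity_eq_holds hDopen hDord (hρageo.mono (subset_univ D)) hgeo hDκ h0eq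
      hveq
  have heq : EqOn γ ρa D := fun x hx ↦ (huniq hx).symm
  -- the closure of `D` contains `0`
  have hcl : (0 : ℝ) ∈ closure D := by
    rcases lt_or_gt_of_ne hκ with hk | hk
    · have hD' : D = Iio 0 := by
        ext s
        simp only [hD_def, mem_setOf_eq, mem_Iio]
        constructor
        · intro h
          by_contra h'
          have := mul_nonpos_of_nonpos_of_nonneg hk.le (not_lt.mp h')
          linarith
        · intro h
          exact mul_pos_of_neg_of_neg hk h
      rw [hD', closure_Iio]
      exact self_mem_Iic
    · have hD' : D = Ioi 0 := by
        ext s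
        simp only [hD_def, mem_setOf_eq, mem_Ioi]
        exact mul_pos_iff_of_pos_left hk
      rw [hD', closure_Ioi]
      exact self_mem_Ici
  haveI hbot : (𝓝[D] (0 : ℝ)).NeBot := mem_closure_iff_nhdsWithin_neBot.mp hcl
  -- limits along `𝓝[D] 0` of the tangent lift of the extension
  set q : 𝓑.carrier := ρa 0 with hq_def
  set e := trivializationAt E4 (TangentSpace (𝓡 4) : 𝓑.carrier → Type _) q with he_def
  have hqe : q ∈ e.baseSet := FiberBundle.mem_baseSet_trivializationAt' q
  have hz : tangentLift (𝓡 4) ρa 0 ∈ e.source := by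
    rw [e.mem_source]
    exact hqe
  have htend : Tendsto (tangentLift (𝓡 4) ρa) (𝓝[D] 0) (𝓝 (tangentLift (𝓡 4) ρa 0)) :=
    ((hρageo.1 0 (mem_univ 0)).continuousAt.tendsto).mono_left nhdsWithin_le_nhds
  obtain ⟨hA, hB⟩ := (e.tendsto_nhds_iff hz).1 htend
  have hA' : Tendsto ρa (𝓝[D] 0) (𝓝 q) := by
    simpa [Function.comp_def] using hA
  have hevD : ∀ᶠ s in 𝓝[D] 0, s ∈ D := eventually_mem_nhdsWithin
  have hevB : ∀ᶠ s in 𝓝[D] 0, ρa s ∈ e.baseSet := hA' (e.open_baseSet.mem_nhds hqe)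
  -- (i) the section `T` along `ρa` tends to `T q`
  have hz' : (TotalSpace.mk' E4 q (𝓑.killing q) : TangentBundle (𝓡 4) 𝓑.carrier) ∈ e.source := by
    rw [e.mem_source]
    exact hqe
  have hsec : Tendsto (fun s ↦ (e (TotalSpace.mk' E4 (ρa s) (𝓑.killing (ρa s)))).2) (𝓝[D] 0)
      (𝓝 (e (TotalSpace.mk' E4 q (𝓑.killing q))).2) := by
    have h1 : Tendsto (fun s ↦ (TotalSpace.mk' E4 (ρa s) (𝓑.killing (ρa s)) :
        TangentBundle (𝓡 4) 𝓑.carrier)) (𝓝[D] 0) (𝓝 (TotalSpace.mk' E4 q (𝓑.killing q))) :=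
      (mdifferentiableAt_killing q).continuousAt.tendsto.comp hA'
    exact ((e.tendsto_nhds_iff hz').1 h1).2
  -- (ii) along `D` the same quantity is `(κ s) • (e (ρa s, γ̇' s)).2`, which tends to `0`
  have hEq : ∀ᶠ s in 𝓝[D] 0, (e (TotalSpace.mk' E4 (ρa s) (𝓑.killing (ρa s)))).2 =
      (κ * s) • (e (tangentLift (𝓡 4) ρa s)).2 := by
    filter_upwards [hevD, hevB] with s hsD hsB
    have hs0 : s ≠ 0 := hD0 s hsD
    have hγρa : γ s = ρa s := heq hsD
    have hloc : ρa =ᶠ[𝓝 s] γ :=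
      Filter.eventuallyEq_of_mem (hDopen.mem_nhds hsD) fun x hx ↦ (heq hx).symm
    have hT : (TotalSpace.mk' E4 (ρa s) (𝓑.killing (ρa s)) : TangentBundle (𝓡 4) 𝓑.carrier) =
        TotalSpace.mk' E4 (γ s) ((κ * s) • velocity (𝓡 4) γ s) := by
      rw [hvel s hs0, smul_smul, mul_inv_cancel₀ (mul_ne_zero hκ hs0), one_smul, hγρa]
    have hsB' : γ s ∈ e.baseSet := by rwa [hγρa]
    rw [hT, (e.linear ℝ hsB').map_smul, tangentLift_congr_of_eventuallyEq hloc]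
    rfl
  have hlim0 : Tendsto (fun s : ℝ ↦ (κ * s) • (e (tangentLift (𝓡 4) ρa s)).2) (𝓝[D] 0)
      (𝓝 ((κ * 0) • (e (tangentLift (𝓡 4) ρa 0)).2)) :=
    ((((continuous_const.mul continuous_id).tendsto (0 : ℝ)).mono_left
      nhdsWithin_le_nhds).smul hB)
  rw [mul_zero, zero_smul] at hlim0
  have hTq0 : (e (TotalSpace.mk' E4 q (𝓑.killing q))).2 = 0 :=
    tendsto_nhds_unique_of_eventuallyEq hsec hlim0 hEq
  have hTq : 𝓑.killing q = 0 := by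
    rw [← (e.continuousLinearEquivAt ℝ q hqe).map_eq_zero_iff,
      Trivialization.continuousLinearEquivAt_apply]
    exact hTq0

  -- `q = ρ b` is a point of the d.o.c. where `T` vanishes
  exact hT0 q (hρdoc (a * 0 + b)) hTq

/-- **Complete on-wall rays are hovering light lines** (registered certificate
`onWall_complete_ray_isHovering` of crux stmt-FinalStateConjecture-17838).  For a hole with
`T ≠ 0` on its d.o.c.: a geodesic `γ` defined on all of `ℝ`, null with `γ̇ ≠ 0` and of zero
energy, lying in the `T`-orbit of a subset `S ⊆ ⟨⟨M_ext⟩⟩` and never entering `{g(T,T) > 0}`,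
satisfies `g(T,T) = 0` AND `∇_T T = 0` at each of its points: by the cage lemma it runs in
`{g(T,T) = 0} ∩ ⟨⟨M_ext⟩⟩`, its velocity is a non-zero multiple of `T`, the geodesic equation gives
`∇_T T = κ T` at `γ t` (`exists_cov_self_eq_smul_of_velocity_parallel`, p135563), and `κ ≠ 0` is
excluded by `false_of_complete_geodesic_through_incompleteLightPoint`.  So a restate of the crux
with `s = Set.univ` leaves, on the wall, only the HOVERING species of `LightPointBomb`.
[cite: ONeill1983, Ch. 3, Lemma 3.22] -/
theorem onWall_complete_ray_isHovering :
    ∀ (𝓑 : Literature.Geometry.Lorentzian.StationaryAFBlackHole.{0}) [𝓑.metric.HasLeviCivita], (∀ p ∈ 𝓑.doc, 𝓑.killing p ≠ 0) → ∀ S : Set 𝓑.carrier, S ⊆ 𝓑.doc → ∀ (γ : ℝ → 𝓑.carrier), Literature.Geometry.Lorentzian.IsGeodesicOn 𝓑.metric.toPseudoRiemannianMetric.leviCivita γ Set.univ → (∀ t : ℝ, 𝓑.metric.val (γ t) (Literature.Geometry.Lorentzian.velocity (𝓡 4) γ t) (Literature.Geometry.Lorentzian.velocity (𝓡 4) γ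 t) = 0 ∧ Literature.Geometry.Lorentzian.velocity (𝓡 4) γ t ≠ 0 ∧ 𝓑.metric.val (γ t) (Literature.Geometry.Lorentzian.velocity (𝓡 4) γ t) (𝓑.killing (γ t)) = 0) → (∀ t : ℝ, γ t ∈ Literature.Geometry.Lorentzian.stationaryOrbit 𝓑.killing S) → (∀ t : ℝ, 𝓑.metric.val (γ t) (𝓑.killing (γ t)) (𝓑.killing (γ t)) ≤ 0) → ∀ t : ℝ, 𝓑.metric.val (γ t) (𝓑.killing (γ t)) (𝓑.killing (γ t)) = 0 ∧ 𝓑.metric.leviCivita 𝓑.killing (γ t) (𝓑.killing (γ t)) = 0 := by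
  intro 𝓑 _ hT0 S hSdoc γ hgeo hz htrap hwall t₀
  -- the geodesic lies in the d.o.c.
  have hdoc : ∀ t, γ t ∈ 𝓑.doc := fun t ↦ by
    obtain ⟨δ, hδ, hδ0, u, hu⟩ := htrap t
    rw [← hu]
    exact StationaryAFBlackHole.mem_doc_of_isMIntegralCurve hδ (hSdoc hδ0) u
  -- `g(T,T) = 0` along the geodesic
  have hlam : ∀ t, 𝓑.metric.val (γ t) (𝓑.killing (γ t)) (𝓑.killing (γ t)) = 0 := fun t ↦
    le_antisymm (hwall t) (𝓑.killing_sq_nonneg_of_zeroEnergyNull (hz t).1 (hz t).2.1 (hz t).2.2)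
  -- the velocity is a multiple of `T`
  have hpar : ∀ t, ∃ a : ℝ, velocity (𝓡 4) γ t = a • 𝓑.killing (γ t) := fun t ↦ by
    obtain ⟨w, hw⟩ := 𝓑.metric.exists_timelike (γ t)
    exact exists_smul_of_orthogonal_null (V := E4) (𝓑.metric.val (γ t)) (𝓑.metric.symm (γ t))
      (fun a b ha hab hb ↦ 𝓑.metric.pos_of_orthogonal (γ t) a b ha hab hb) hw (hlam t)
      (hT0 _ (hdoc t)) (hz t).2.2 (hz t).1
  refine ⟨hlam t₀, ?_⟩
  -- the geodesic equation makes `γ t₀` a light point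
  obtain ⟨κ, hκ⟩ := exists_cov_self_eq_smul_of_velocity_parallel
    𝓑.metric.toPseudoRiemannianMetric.leviCivita (hgeo.1 t₀ (mem_univ t₀)) (hgeo.2 t₀ (mem_univ t₀))
    (mdifferentiableAt_killing (γ t₀)) (Filter.Eventually.of_forall hpar) (hz t₀).2.1
  rcases eq_or_ne κ 0 with rfl | hκ0
  · rwa [zero_smul] at hκ
  · exfalso
    obtain ⟨a, ha⟩ := hpar t₀
    have ha0 : a ≠ 0 := by
      rintro rfl
      exact (hz t₀).2.1 (by rw [ha, zero_smul])
    exact false_of_complete_geodesic_through_incompleteLightPoint hT0 (hdoc t₀) (hlam t₀) hκ0 hκ hgeo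
      hdoc rfl ha0 ha

end Summit.FinalStateConjecture.FinalStateConjecture.Theorems.ErgoregionBombModT

end
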